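import Mathlib
import Literature.MathematicalPhysics.KineticTheory.HardSphereEuler
import HarnessLib

/-!
# 3-D isotropy of hard-sphere scattering
(crux stmt-AtomisticToContinuum-14535, line `Sketch`, registered stub `stub_isotropy`)

For a unit vector `g ∈ ℝ³` and a measurable `B ⊆ ℝ³`, the flux measure `(−⟪ω, g⟫)₊ dσ(ω)` of the
incoming hemisphere, pushed forward by the specular map `ω ↦ g − 2⟪ω, g⟫ω`, charges `B` with mass
`¼ σ(B ∩ S²)` (`σ = sphereMeasure = volume.toSphere`): the differential cross-section of hard
spheres in three dimensions is constant (Cercignani–Illner–Pulvirenti 1994 §3.1;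
Gallagher–Saint-Raymond–Texier 2013 §2.1).

Proof without spherical coordinates: the radial extension `Ψ_g(x) = |x|² g − 2⟪x, g⟫ x` of the
specular map sends the open half-space `{⟪x, g⟫ < 0}` injectively onto the complement of the line
`ℝ g`, with `|Ψ_g(x)| = |x|²`, `Ψ_g(x)/|Ψ_g(x)| = g − 2⟪x̂, g⟫ x̂` and Jacobian
`|det DΨ_g(x)| = 8 |x|² |⟪x, g⟫|`. Mathlib's change of variables
(`lintegral_image_eq_lintegral_abs_det_fderiv_mul`) applied to `y ↦ 1_B(y/|y|) 1_{|y| < 1}` and the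
polar factorisation of Lebesgue measure (`measurePreserving_homeomorphUnitSphereProd`:
`dx = dσ ⊗ r² dr`) on both sides give `σ(B ∩ S²) · ⅓ = (flux integral) · 8 · ⅙`.
No new definitions; only Mathlib and the tree's `sphereMeasure`, `V3`.
-/

open MeasureTheory Set
open scoped ENNReal InnerProductSpace
open Literature.MathematicalPhysics.KineticTheory

namespace Summit.AtomisticToContinuum.HydrodynamicLimit.Theorems

/-! ## The radial extension `Ψ_g(x) = |x|² g − 2⟪x, g⟫ x` of the specular map -/

/-- Jacobian determinant of the radial extension `Ψ_g(x) = |x|² g − 2⟪x, g⟫ x` of the specular map: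
`det DΨ_g(x) = −8 ⟪x, g⟫ |x|²` for a unit vector `g ∈ ℝ³`. [folklore] -/
theorem det_fderiv_specularExtension (g x : V3) (hg : ‖g‖ = 1) :
    ((2 : ℝ) • (innerSL ℝ x).smulRight g - (2 : ℝ) • (innerSL ℝ g).smulRight x
      - (2 * ⟪x, g⟫_ℝ) • ContinuousLinearMap.id ℝ V3).det = -8 * ⟪x, g⟫_ℝ * ‖x‖ ^ 2 := by
  have hg' : ⟪g, g⟫_ℝ = 1 := by rw [real_inner_self_eq_norm_sq, hg]; norm_num
  rw [← real_inner_self_eq_norm_sq]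
  rw [ContinuousLinearMap.det, ← LinearMap.det_toMatrix (EuclideanSpace.basisFun (Fin 3) ℝ).toBasis,
    Matrix.det_fin_three]
  simp only [LinearMap.toMatrix_apply, OrthonormalBasis.coe_toBasis,
    OrthonormalBasis.coe_toBasis_repr_apply, EuclideanSpace.basisFun_repr,
    EuclideanSpace.basisFun_apply, ContinuousLinearMap.coe_coe, sub_apply, smul_apply,
    ContinuousLinearMap.smulRight_apply, innerSL_apply_apply, ContinuousLinearMap.id_apply,
    PiLp.sub_apply, PiLp.smul_apply, smul_eq_mul, EuclideanSpace.inner_single_right,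
    PiLp.single_apply]
  simp only [PiLp.inner_apply, Fin.sum_univ_three, RCLike.inner_apply, conj_trivial] at hg' ⊢
  simp only [Fin.isValue, Fin.reduceEq, ↓reduceIte] at hg' ⊢
  linear_combination (-8 * (g.ofLp 0 * x.ofLp 0 + g.ofLp 1 * x.ofLp 1 + g.ofLp 2 * x.ofLp 2) *
      (x.ofLp 0 * x.ofLp 0 + x.ofLp 1 * x.ofLp 1 + x.ofLp 2 * x.ofLp 2)) * hg'

/-- The radial extension `Ψ_g(x) = |x|² g − 2⟪x, g⟫ x` of the specular map is differentiable, with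
`DΨ_g(x) h = 2⟪x, h⟫ g − 2⟪h, g⟫ x − 2⟪x, g⟫ h`. [folklore] -/
theorem hasFDerivAt_specularExtension (g x : V3) :
    HasFDerivAt (fun y : V3 => (‖y‖ ^ 2) • g - (2 * ⟪y, g⟫_ℝ) • y)
      ((2 : ℝ) • (innerSL ℝ x).smulRight g - (2 : ℝ) • (innerSL ℝ g).smulRight x
        - (2 * ⟪x, g⟫_ℝ) • ContinuousLinearMap.id ℝ V3) x := by
  have h1 : HasFDerivAt (fun y : V3 => (‖y‖ ^ 2) • g) ((2 • innerSL ℝ x).smulRight g) x :=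
    (hasStrictFDerivAt_norm_sq x).hasFDerivAt.smul_const g
  have h2 : HasFDerivAt (fun y : V3 => 2 * ⟪y, g⟫_ℝ) ((2 : ℝ) • innerSL ℝ g) x := by
    have h : HasFDerivAt (fun y : V3 => ⟪y, g⟫_ℝ) (innerSL ℝ g) x := by
      have heq : (fun y : V3 => ⟪y, g⟫_ℝ) = innerSL ℝ g := by
        funext y
        rw [innerSL_apply_apply, real_inner_comm]
      rw [heq]
      exact (innerSL ℝ g).hasFDerivAt
    exact h.const_mul 2
  have h3 := h2.smul (hasFDerivAt_id x)
  refine (h1.sub h3).congr_fderiv ?_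
  ext h i
  simp only [sub_apply, smul_apply, ContinuousLinearMap.smulRight_apply, innerSL_apply_apply,
    ContinuousLinearMap.id_apply, add_apply, PiLp.sub_apply, PiLp.smul_apply,
    PiLp.add_apply, smul_eq_mul, nsmul_eq_mul, Nat.cast_ofNat, id_eq]
  ring

/-- `|Ψ_g(x)| = |x|²` for a unit vector `g`. [folklore] -/
theorem norm_specularExtension (g x : V3) (hg : ‖g‖ = 1) :
    ‖(‖x‖ ^ 2) • g - (2 * ⟪x, g⟫_ℝ) • x‖ = ‖x‖ ^ 2 := by
  have h : ‖(‖x‖ ^ 2) • g - (2 * ⟪x, g⟫_ℝ) • x‖ ^ 2 = (‖x‖ ^ 2) ^ 2 := by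
    rw [norm_sub_sq_real, norm_smul, norm_smul, real_inner_smul_left, real_inner_smul_right, hg,
      real_inner_comm g x, Real.norm_eq_abs, Real.norm_eq_abs, mul_pow, mul_pow, sq_abs, sq_abs]
    ring
  exact (pow_left_inj₀ (norm_nonneg _) (by positivity) two_ne_zero).1 h

/-- `Ψ_g` is injective on the open half-space `{⟪x, g⟫ < 0}`. [folklore] -/
theorem injOn_specularExtension (g : V3) (hg : ‖g‖ = 1) :
    InjOn (fun y : V3 => (‖y‖ ^ 2) • g - (2 * ⟪y, g⟫_ℝ) • y) {x | ⟪x, g⟫_ℝ < 0} := by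
  intro x hx y hy hxy
  simp only [mem_setOf_eq] at hx hy hxy
  have hn : ‖x‖ ^ 2 = ‖y‖ ^ 2 := by
    rw [← norm_specularExtension g x hg, ← norm_specularExtension g y hg, hxy]
  rw [hn, sub_right_inj] at hxy
  have h3 : 2 * ⟪x, g⟫_ℝ * ⟪x, g⟫_ℝ = 2 * ⟪y, g⟫_ℝ * ⟪y, g⟫_ℝ := by
    have := congrArg (fun z => ⟪z, g⟫_ℝ) hxy
    simpa only [real_inner_smul_left] using this
  have h4 : ⟪x, g⟫_ℝ = ⟪y, g⟫_ℝ := by nlinarith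
  rw [h4] at hxy
  exact smul_right_injective V3 (by nlinarith : 2 * ⟪y, g⟫_ℝ ≠ 0) hxy

/-- Every vector off the line `ℝ g` is a value `Ψ_g(x)` with `⟪x, g⟫ < 0`. [folklore] -/
theorem mem_image_specularExtension (g : V3) (hg : ‖g‖ = 1) {y : V3} (hy : y ∉ (ℝ ∙ g)) :
    y ∈ (fun x : V3 => (‖x‖ ^ 2) • g - (2 * ⟪x, g⟫_ℝ) • x) '' {x | ⟪x, g⟫_ℝ < 0} := by
  have hy0 : y ≠ 0 := fun h => hy (h ▸ Submodule.zero_mem _)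
  have hr0 : 0 < ‖y‖ := norm_pos_iff.2 hy0
  set yh : V3 := ‖y‖⁻¹ • y with hyh
  have hyh1 : ‖yh‖ = 1 := by
    rw [hyh, norm_smul, norm_inv, norm_norm, inv_mul_cancel₀ hr0.ne']
  have hne : yh ≠ g := by
    intro h
    apply hy
    rw [Submodule.mem_span_singleton]
    exact ⟨‖y‖, by rw [← h, hyh, smul_smul, mul_inv_cancel₀ hr0.ne', one_smul]⟩
  set u : V3 := g - yh with hu
  have hug : ⟪u, g⟫_ℝ = 1 - ⟪yh, g⟫_ℝ := by
    rw [hu, inner_sub_left, real_inner_self_eq_norm_sq, hg]; ring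
  have hlt : ⟪yh, g⟫_ℝ < 1 := (inner_lt_one_iff_real_of_norm_eq_one hyh1 hg).2 hne
  have hug0 : 0 < ⟪u, g⟫_ℝ := by linarith
  have hu2 : ‖u‖ ^ 2 = 2 * ⟪u, g⟫_ℝ := by
    rw [hu, norm_sub_sq_real, hg, hyh1, inner_sub_left, real_inner_self_eq_norm_sq, hg,
      real_inner_comm]
    ring
  have hu0 : 0 < ‖u‖ := norm_pos_iff.2 (sub_ne_zero.2 hne.symm)
  set c : ℝ := -(Real.sqrt ‖y‖ * ‖u‖⁻¹) with hc
  have hc2 : c ^ 2 * ‖u‖ ^ 2 = ‖y‖ := by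
    rw [hc, neg_sq, mul_pow, Real.sq_sqrt hr0.le, inv_pow, mul_assoc,
      inv_mul_cancel₀ (by positivity), mul_one]
  have hc0 : c < 0 := by rw [hc]; exact neg_neg_of_pos (by positivity)
  refine ⟨c • u, ?_, ?_⟩
  · show ⟪c • u, g⟫_ℝ < 0
    rw [real_inner_smul_left]
    exact mul_neg_of_neg_of_pos hc0 hug0
  · show (‖c • u‖ ^ 2) • g - (2 * ⟪c • u, g⟫_ℝ) • c • u = y
    have hn : ‖c • u‖ ^ 2 = ‖y‖ := by rw [norm_smul, mul_pow, Real.norm_eq_abs, sq_abs, hc2]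
    have hs : 2 * (c * ⟪u, g⟫_ℝ) * c = ‖y‖ := by
      rw [← hc2, hu2]; ring
    rw [hn, real_inner_smul_left, smul_smul, hs, ← smul_sub, hu, sub_sub_cancel, hyh, smul_smul,
      mul_inv_cancel₀ hr0.ne', one_smul]

/-! ## Polar factorisation of Lebesgue measure and two radial integrals -/

/-- **Polar coordinates in `ℝ³`** (Mathlib's `measurePreserving_homeomorphUnitSphereProd`): if
`F(x) = a(x/|x|) b(|x|)` off the origin, then `∫ F dx = (∫_{S²} a dσ) (∫₀^∞ b(r) r² dr)`.
[folklore] -/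
theorem lintegral_eq_lintegral_toSphere_mul (F : V3 → ℝ≥0∞)
    (a : Metric.sphere (0 : V3) 1 → ℝ≥0∞) (b : ℝ → ℝ≥0∞) (ha : Measurable a) (hb : Measurable b)
    (hF : ∀ x : ({(0 : V3)}ᶜ : Set V3),
      F x = a (homeomorphUnitSphereProd V3 x).1 * b ‖(x : V3)‖) :
    ∫⁻ x, F x = (∫⁻ ω, a ω ∂(volume : Measure V3).toSphere) *
      ∫⁻ r in Ioi (0 : ℝ), b r * ENNReal.ofReal (r ^ 2) := by
  have hdim : Module.finrank ℝ V3 - 1 = 2 := by rw [finrank_euclideanSpace_fin]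
  have hmp := (volume : Measure V3).measurePreserving_homeomorphUnitSphereProd
  rw [hdim] at hmp
  calc ∫⁻ x, F x = ∫⁻ x : ({(0 : V3)}ᶜ : Set V3), F x ∂(Measure.comap Subtype.val volume) := by
        rw [lintegral_subtype_comap (measurableSet_singleton _).compl, restrict_compl_singleton]
    _ = ∫⁻ x : ({(0 : V3)}ᶜ : Set V3), (fun p : Metric.sphere (0 : V3) 1 × Ioi (0 : ℝ) =>
          a p.1 * b p.2) (homeomorphUnitSphereProd V3 x) ∂(Measure.comap Subtype.val volume) := by
        congr 1
        funext x
        simp only [hF x, homeomorphUnitSphereProd_apply_snd_coe]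
    _ = ∫⁻ p, a p.1 * b p.2 ∂((volume : Measure V3).toSphere.prod (Measure.volumeIoiPow 2)) :=
        hmp.lintegral_comp_emb (Homeomorph.measurableEmbedding _)
          (fun p : Metric.sphere (0 : V3) 1 × Ioi (0 : ℝ) => a p.1 * b p.2)
    _ = (∫⁻ ω, a ω ∂(volume : Measure V3).toSphere) * ∫⁻ r, b r ∂(Measure.volumeIoiPow 2) :=
        lintegral_prod_mul ha.aemeasurable (hb.comp measurable_subtype_coe).aemeasurable
    _ = _ := by
        congr 1
        rw [Measure.volumeIoiPow, lintegral_withDensity_eq_lintegral_mul _ (by fun_prop)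
            (g := fun r : Ioi (0 : ℝ) => b r) (hb.comp measurable_subtype_coe),
          ← lintegral_subtype_comap measurableSet_Ioi (fun r => b r * ENNReal.ofReal (r ^ 2))]
        congr 1
        funext r
        simp only [Pi.mul_apply, mul_comm]

/-- `∫₀^1 c rᵏ · r² dr = c / (k + 3)` as a Lebesgue integral over `(0, ∞)`. [folklore] -/
theorem lintegral_Ioi_indicator_pow_mul_sq (c : ℝ) (hc : 0 ≤ c) (k : ℕ) :
    ∫⁻ r in Ioi (0 : ℝ), (Iio (1 : ℝ)).indicator (fun r => ENNReal.ofReal (c * r ^ k)) r *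
        ENNReal.ofReal (r ^ 2) = ENNReal.ofReal (c / (k + 3)) := by
  have h : ∀ r : ℝ, (Iio (1 : ℝ)).indicator (fun r => ENNReal.ofReal (c * r ^ k)) r *
      ENNReal.ofReal (r ^ 2) =
        (Iio (1 : ℝ)).indicator (fun r => ENNReal.ofReal (c * r ^ (k + 2))) r := by
    intro r
    by_cases hr : r ∈ Iio (1 : ℝ)
    · rw [indicator_of_mem hr, indicator_of_mem hr, ← ENNReal.ofReal_mul' (by positivity), pow_add,
        mul_assoc]
    · rw [indicator_of_notMem hr, indicator_of_notMem hr, zero_mul]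
  simp_rw [h]
  rw [lintegral_indicator measurableSet_Iio, Measure.restrict_restrict measurableSet_Iio,
    Iio_inter_Ioi, Measure.restrict_congr_set Ioo_ae_eq_Ioc,
    ← ofReal_integral_eq_lintegral_ofReal
      ((intervalIntegral.intervalIntegrable_pow _).1.const_mul c),
    ← intervalIntegral.integral_of_le zero_le_one, intervalIntegral.integral_const_mul,
    integral_pow]
  · congr 1
    rw [one_pow, zero_pow (by positivity), sub_zero]
    push_cast
    ring
  · filter_upwards [ae_restrict_mem measurableSet_Ioc] with y hy
    have := hy.1.le
    positivity

/-! ## The isotropy identity -/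

/-- **3-D isotropy of hard-sphere scattering** (registered stub `stub_isotropy` of crux
stmt-AtomisticToContinuum-14535): for `‖g‖ = 1` and measurable `B ⊆ ℝ³`,
`∫ 1_B(g − 2⟪ω, g⟫ω) (−⟪ω, g⟫)₊ dσ(ω) = ¼ σ(B ∩ S²)`. [cite: CIP1994, §3.1] -/
theorem stub_isotropy (g : V3) (hg : ‖g‖ = 1) {B : Set V3} (hB : MeasurableSet B) :
    ∫⁻ ω, {ω' : V3 | g - (2 * inner ℝ ω' g) • ω' ∈ B}.indicator (fun _ => (1 : ℝ≥0∞)) (ω : V3) *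
        ENNReal.ofReal (max (-inner ℝ (ω : V3) g) 0) ∂(sphereMeasure (E := V3)) =
      4⁻¹ * (sphereMeasure (E := V3)) {ω | (ω : V3) ∈ B} := by
  classical
  simp only [sphereMeasure]
  -- the data
  have hSm : MeasurableSet {ω : Metric.sphere (0 : V3) 1 | (ω : V3) ∈ B} :=
    measurable_subtype_coe hB
  have hTB : MeasurableSet {ω' : V3 | g - (2 * ⟪ω', g⟫_ℝ) • ω' ∈ B} :=
    hB.preimage (by fun_prop)
  set a : Metric.sphere (0 : V3) 1 → ℝ≥0∞ := fun ω =>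
    {ω' : V3 | g - (2 * ⟪ω', g⟫_ℝ) • ω' ∈ B}.indicator (fun _ => (1 : ℝ≥0∞)) (ω : V3) *
      ENNReal.ofReal (max (-⟪(ω : V3), g⟫_ℝ) 0) with ha
  have ham : Measurable a :=
    ((measurable_const.indicator hTB).comp measurable_subtype_coe).mul (by fun_prop)
  set Ψ : V3 → V3 := fun x => (‖x‖ ^ 2) • g - (2 * ⟪x, g⟫_ℝ) • x with hΨ
  set F' : V3 → (V3 →L[ℝ] V3) := fun x => (2 : ℝ) • (innerSL ℝ x).smulRight g
    - (2 : ℝ) • (innerSL ℝ g).smulRight x - (2 * ⟪x, g⟫_ℝ) • ContinuousLinearMap.id ℝ V3 with hF'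
  set H : Set V3 := {x | ⟪x, g⟫_ℝ < 0} with hH
  have hHm : MeasurableSet H := measurableSet_lt (by fun_prop) measurable_const
  set f : V3 → ℝ≥0∞ := fun y => {y' : V3 | ‖y'‖⁻¹ • y' ∈ B}.indicator (fun _ => (1 : ℝ≥0∞)) y *
    (Iio (1 : ℝ)).indicator (fun _ => (1 : ℝ≥0∞)) ‖y‖ with hf
  set b₁ : ℝ → ℝ≥0∞ := fun r =>
    (Iio (1 : ℝ)).indicator (fun r => ENNReal.ofReal (1 * r ^ 0)) r with hb₁
  set b₂ : ℝ → ℝ≥0∞ := fun r =>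
    (Iio (1 : ℝ)).indicator (fun r => ENNReal.ofReal (8 * r ^ 3)) r with hb₂
  have hb₁m : Measurable b₁ :=
    (by fun_prop : Measurable fun r : ℝ => ENNReal.ofReal (1 * r ^ 0)).indicator measurableSet_Iio
  have hb₂m : Measurable b₂ :=
    (by fun_prop : Measurable fun r : ℝ => ENNReal.ofReal (8 * r ^ 3)).indicator measurableSet_Iio
  -- change of variables
  have hcov := lintegral_image_eq_lintegral_abs_det_fderiv_mul volume hHm (f := Ψ) (f' := F')
    (fun x _ => (hasFDerivAt_specularExtension g x).hasFDerivWithinAt)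
    (injOn_specularExtension g hg) f
  -- the image has full measure
  have hspan : (ℝ ∙ g : Submodule ℝ V3) ≠ ⊤ := by
    intro htop
    have h1 : Module.finrank ℝ (ℝ ∙ g) ≤ 1 := (finrank_span_le_card ({g} : Set V3)).trans (by simp)
    rw [htop, finrank_top, finrank_euclideanSpace_fin] at h1
    omega
  have hnull : volume ((Ψ '' H)ᶜ) = 0 :=
    measure_mono_null (fun y hy => by_contra fun hy' => hy (mem_image_specularExtension g hg hy'))
      (Measure.addHaar_submodule volume (ℝ ∙ g) hspan)
  -- left-hand side in polar coordinates
  have hF₁ : ∀ x : ({(0 : V3)}ᶜ : Set V3), f x =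
      {ω : Metric.sphere (0 : V3) 1 | (ω : V3) ∈ B}.indicator 1 (homeomorphUnitSphereProd V3 x).1 *
        b₁ ‖(x : V3)‖ := by
    intro x
    simp only [hf, hb₁, indicator, mem_setOf_eq, homeomorphUnitSphereProd_apply_fst_coe,
      Pi.one_apply, one_mul, pow_zero, ENNReal.ofReal_one]
  have hL : ∫⁻ y in Ψ '' H, f y =
      (volume : Measure V3).toSphere {ω : Metric.sphere (0 : V3) 1 | (ω : V3) ∈ B} *
        ENNReal.ofReal (1 / ((0 : ℕ) + 3)) := by
    rw [Measure.restrict_congr_set (ae_eq_univ.2 hnull), Measure.restrict_univ,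
      lintegral_eq_lintegral_toSphere_mul f _ b₁ (measurable_one.indicator hSm) hb₁m hF₁,
      lintegral_indicator_one hSm, hb₁, lintegral_Ioi_indicator_pow_mul_sq 1 zero_le_one 0]
  -- right-hand side in polar coordinates
  have hF₂ : ∀ x : ({(0 : V3)}ᶜ : Set V3),
      H.indicator (fun x => ENNReal.ofReal |(F' x).det| * f (Ψ x)) x =
        a (homeomorphUnitSphereProd V3 x).1 * b₂ ‖(x : V3)‖ := by
    intro x
    have hx0 : (x : V3) ≠ 0 := x.2
    have hn0 : ‖(x : V3)‖ ≠ 0 := norm_ne_zero_iff.2 hx0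
    have hdet : (F' x).det = -8 * ⟪(x : V3), g⟫_ℝ * ‖(x : V3)‖ ^ 2 :=
      det_fderiv_specularExtension g x hg
    have hΨn : ‖Ψ x‖ = ‖(x : V3)‖ ^ 2 := norm_specularExtension g x hg
    have hΨu : (‖(x : V3)‖ ^ 2)⁻¹ • Ψ x =
        g - (2 * ⟪‖(x : V3)‖⁻¹ • (x : V3), g⟫_ℝ) • (‖(x : V3)‖⁻¹ • (x : V3)) := by
      rw [hΨ]
      simp only
      rw [smul_sub, smul_smul, smul_smul, real_inner_smul_left, inv_mul_cancel₀ (pow_ne_zero 2 hn0),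
        one_smul, smul_smul]
      congr 2
      field_simp
    have hxhat : ⟪‖(x : V3)‖⁻¹ • (x : V3), g⟫_ℝ = ‖(x : V3)‖⁻¹ * ⟪(x : V3), g⟫_ℝ :=
      real_inner_smul_left _ _ _
    simp only [indicator, hH, mem_setOf_eq, hf, ha, hb₂, hdet, hΨu, hΨn,
      homeomorphUnitSphereProd_apply_fst_coe, mem_Iio, sq_lt_one_iff₀ (norm_nonneg _), hxhat]
    by_cases hxg : ⟪(x : V3), g⟫_ℝ < 0
    · have h0 : 0 ≤ -(‖(x : V3)‖⁻¹ * ⟪(x : V3), g⟫_ℝ) :=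
        neg_nonneg.2 (mul_nonpos_of_nonneg_of_nonpos (inv_nonneg.2 (norm_nonneg _)) hxg.le)
      have habs : |-8 * ⟪(x : V3), g⟫_ℝ * ‖(x : V3)‖ ^ 2| =
          -(‖(x : V3)‖⁻¹ * ⟪(x : V3), g⟫_ℝ) * (8 * ‖(x : V3)‖ ^ 3) := by
        rw [abs_of_nonneg (by nlinarith [hxg, sq_nonneg ‖(x : V3)‖])]
        field_simp
      rw [if_pos hxg, max_eq_left h0, habs, ENNReal.ofReal_mul h0]
      split_ifs <;> ring
    · have h0 : -(‖(x : V3)‖⁻¹ * ⟪(x : V3), g⟫_ℝ) ≤ 0 :=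
        neg_nonpos.2 (mul_nonneg (inv_nonneg.2 (norm_nonneg _)) (not_lt.1 hxg))
      rw [if_neg hxg, max_eq_right h0, ENNReal.ofReal_zero, mul_zero, zero_mul]
  -- assemble: `σ(B ∩ S²) · ⅓ = I · 8/6`
  rw [hL, ← lintegral_indicator hHm, lintegral_eq_lintegral_toSphere_mul _ a b₂ ham hb₂m hF₂, hb₂,
    lintegral_Ioi_indicator_pow_mul_sq 8 (by norm_num) 3] at hcov
  have hSfin : (volume : Measure V3).toSphere {ω : Metric.sphere (0 : V3) 1 | (ω : V3) ∈ B} ≠ ⊤ :=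
    measure_ne_top _ _
  have hIfin : ∫⁻ ω, a ω ∂(volume : Measure V3).toSphere ≠ ⊤ := by
    intro htop
    rw [htop, ENNReal.top_mul (ENNReal.ofReal_ne_zero_iff.2 (by norm_num))] at hcov
    exact ENNReal.mul_ne_top hSfin ENNReal.ofReal_ne_top hcov
  refine (ENNReal.toReal_eq_toReal_iff' hIfin (ENNReal.mul_ne_top (by simp) hSfin)).1 ?_
  have h := congrArg ENNReal.toReal hcov
  rw [ENNReal.toReal_mul, ENNReal.toReal_mul, ENNReal.toReal_ofReal (by norm_num),
    ENNReal.toReal_ofReal (by norm_num)] at h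
  rw [ENNReal.toReal_mul, ENNReal.toReal_inv, ENNReal.toReal_ofNat]
  push_cast at h
  linarith

end Summit.AtomisticToContinuum.HydrodynamicLimit.Theorems
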